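/-
Copyright (c) 2026 the pub-hodgecm-mathlib formalisation cell (harness21).  Prover seat hodgecm-mathlib-F0P2-p11 (g2) (L1; LEAD F0P6-plan (g14) BATCH #56∕#61 «(o1) KIND 1»;
desk K2E5-p17 (g8) 22:12:51Z «#41 TOP ED. 16 = KIND 1 AT THE LETTERS OF RECORD»), Track B «K2-LIT» ∕ hLiu418 #184♮, ROAD Φ, G5-b: THE KIND-1 WEIGHTS `(ub, uG, hub, huG, hbg, haG, hws)`
OF THE LETTERS OF RECORD FROM DECAY AND SUPPORT LETTERS ON `Ebc`, `Eac` ALONE (K2E4-p10's ★ generic `exists_whittaker_weight` at `GW := 1`).  THEOREMS ONLY.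
-/
import Summits.HodgeConjecture.HodgeConjecture.Theorems.K2LiuWhittakerWeightedGrowthInstance   -- ★ p862095 `exists_whittaker_weight` (generic summable lattice weight)
import HarnessLib

/-!
# Crux `HLiu418`, socket #41, KIND 1 — the WEIGHT LETTERS of the KIND-1 block at the letters of record (★ `K2LiuKindOneLettersOfRecord`, TOP ED. 16) from (L-dec) + (L-supp) on
# the two continued cell terms `Ebc`, `Eac` alone

Cell `hodgecm-mathlib`, crux item hLiu418 = `stmt-HodgeConjecture-24832` (helper lane, count-neutral); squad K2 ∕ K2Liu, LEAD F0P6-plan (g14); desk K2E5-p17 (g8→g9); prover F0P2-p11 (g2).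
THEOREMS ONLY (no `def`, no `instance`, no notation, no named-fact hypothesis, no `sorry`).

THE POINT.  After ★ `K2LiuKindOneLettersOfRecord` (p862409) the KIND-1 block of the TOP (ED. 16) is `(Ebc hEbd ub hub hbg hEbc) (Eac hEad uG huG haG hEac) (hws)`: two functions
`Ebc, Eac : Skew → ℂ → H(𝔸) → ℂ` (continued normalised middle-cell term ∕ continued `(s − ½)·`normalised Whittaker term), their holomorphy, their pins at one carrier, and WEIGHTED
GROWTHS `‖Ebc S s h‖ ≤ C(z)·ub(S)·‖h‖^A`, `‖Eac S s h‖ ≤ C(z)·uG(S)·‖h‖^A` with `ub, uG ≥ 0` and `Summable (ub + uG)` over the TOP's whole Fourier lattice `Skew`.  Exactly as for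
KIND W (K2E4-p10 (g8) ★ p862095), an `h`-independent summable weight must decay in the archimedean SIZE and in the DENOMINATOR of `S`, and it comes for free from two letters on
the function alone: (L-dec) height-form Gaussian decay `‖E S s h‖ ≤ C·‖h‖^a·e^{−c‖h‖^{−a′}τ(S)}(1+τ S)^{N}` near each `z` (`0 < re z`), and (L-supp) bounded-denominator support on
`{0 < re s}` (`E S s h ≠ 0 ⇒ ∃ D ≤ C₀‖h‖^κ, D·S integral`) — ★ `exists_whittaker_weight` at `WT := E`, `GW := 1`.
* §1 **`kindOne_weight_of_decay`** — ONE function `E`: (L-dec) + (L-supp) ⇒ `∃ u ≥ 0, Summable u ∧ ‖E S s h‖ ≤ C(z)·u(S)·‖h‖^A` (the TOP's `(ub, hub, hbg)` resp. `(uG, huG, haG)` shape).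
* §2 **`kindOne_weights_of_decay`** — BOTH: the five weight letters `(ub uG hub huG hbg haG hws)` of TOP ED. 16 ∕ ★ `exists_kindOne_sixLetters_of_record` VERBATIM, from
  `(τ hτ)` and the (L-dec)∕(L-supp) letters of `Ebc` and of `Eac`.
WHAT REMAINS of K1-b♮ ∕ K1-a♮ after this file: holomorphy on `{0 < re}`, the pin at one carrier, (L-dec), (L-supp) — four letters per term, all about ONE explicit function each.
References: [MoeglinWaldspurger1995] II.1.7, IV.1.9; [Shimura1997] §18.4, Prop. 18.14; [KudlaRallis1994] §1–§2; [Tan1999] §4 Prop. 4.8.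
HONEST LABEL.  Count-neutral helper, hypothesis-first; `HC_CM` is proved only modulo the 7 printed citations (2 remaining named inputs: hLiu418 = `stmt-HodgeConjecture-24832`,
h413 = `stmt-HodgeConjecture-24833`) until rung 0 closes.
-/

set_option autoImplicit false
set_option linter.dupNamespace false -- the mandated namespace repeats `HodgeConjecture.HodgeConjecture`

noncomputable section

namespace Summit.HodgeConjecture.HodgeConjecture.Cruxes.HLiu418.K2LiuKindOneWeightsOfDecay

open scoped Matrix NNReal BigOperators Classical
open NumberField NumberField.mixedEmbedding IsDedekindDomain Metric
open Literature.NumberTheory.Automorphic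
open Literature.NumberTheory.GelbartRogawski1991 Literature.NumberTheory.GelbartRogawski1991.GRConstruction
open Literature.NumberTheory.K2Lit.SiegelDoubled
open K2LiuSiegelUnipotentFourierDefs
open K2LiuWhittakerWeightedGrowthInstance (exists_whittaker_weight)

variable (L : Type) [Field L] [NumberField L] [IsCMField L] {N M n : ℕ} (hn : 0 < n) (e : Fin N × Fin M ≃ Fin n)
  (dV : Fin N → L) (hdV : ∀ i, IsCMField.complexConj L (dV i) = dV i)
  (dW : Fin M → L) (hdW : ∀ i, IsCMField.complexConj L (dW i) = dW i)

include hn in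
/-- **ONE KIND-1 WEIGHT FROM DECAY AND SUPPORT.**  `E : Skew → ℂ → H(𝔸) → ℂ`, `τ(S) ≥` the sup-norm of the mixed embedding of the entries of `S`; (L-dec) height-form Gaussian
decay of `E` near every `z` with `0 < re z`; (L-supp) bounded-denominator support of `E` on `{0 < re s}`.  THEN `∃ u ≥ 0` SUMMABLE with `‖E S s h‖ ≤ C(z)·u(S)·‖h‖^A` near every `z`
(★ `exists_whittaker_weight` at `WT := E`, `GW := 1`). [cite: MoeglinWaldspurger1995, II.1.7, IV.1.9] [cite: Shimura1997, §18.4, Prop. 18.14] [cite: KudlaRallis1994, §1] -/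
theorem kindOne_weight_of_decay
    (E : skewMatrices ((IsCMField.complexConj L : L ≃ₐ[Fp L] L) : L →+* L) ((gramR L e dV hdV dW hdW).map (algebraMap (Fp L) L)) → ℂ → HA L e dV hdV dW hdW → ℂ)
    (τ : skewMatrices ((IsCMField.complexConj L : L ≃ₐ[Fp L] L) : L →+* L) ((gramR L e dV hdV dW hdW).map (algebraMap (Fp L) L)) → ℝ)
    (hτ : ∀ S : skewMatrices ((IsCMField.complexConj L : L ≃ₐ[Fp L] L) : L →+* L) ((gramR L e dV hdV dW hdW).map (algebraMap (Fp L) L)),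
      ‖(fun i j => mixedEmbedding L ((S : Matrix (Fin n) (Fin n) L) i j))‖ ≤ τ S) (N₀ : ℕ)
    (hdec : ∀ z : ℂ, 0 < z.re → ∃ C a c a' r : ℝ, 0 ≤ C ∧ 0 ≤ a ∧ 0 < c ∧ 0 ≤ a' ∧ 0 < r ∧ ∀ S (s : ℂ), dist s z < r → ∀ h : HA L e dV hdV dW hdW,
      ‖E S s h‖ ≤ C * adelicHeightGL (n + n) L (h : GL (Fin (n + n)) (AdeleRing (𝓞 L) L)) ^ a *
        (Real.exp (-(c * adelicHeightGL (n + n) L (h : GL (Fin (n + n)) (AdeleRing (𝓞 L) L)) ^ (-a') * τ S)) * (1 + τ S) ^ N₀))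
    {C₀ κ : ℝ} (hC₀ : 0 < C₀) (hκ : 0 ≤ κ)
    (hsupp : ∀ S (s : ℂ) (h : HA L e dV hdV dW hdW), 0 < s.re → E S s h ≠ 0 →
      ∃ D : ℕ, 1 ≤ D ∧ (D : ℝ) ≤ C₀ * adelicHeightGL (n + n) L (h : GL (Fin (n + n)) (AdeleRing (𝓞 L) L)) ^ κ ∧
        ∀ i j, IsIntegral ℤ ((D : L) * (S : Matrix (Fin n) (Fin n) L) i j)) :
    ∃ u : skewMatrices ((IsCMField.complexConj L : L ≃ₐ[Fp L] L) : L →+* L) ((gramR L e dV hdV dW hdW).map (algebraMap (Fp L) L)) → ℝ,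
      (∀ S, 0 ≤ u S) ∧ Summable u ∧
      (∀ z : ℂ, 0 < z.re → ∃ C A r : ℝ, 0 ≤ C ∧ 0 ≤ A ∧ 0 < r ∧ ∀ S (s : ℂ), dist s z < r → ∀ h : HA L e dV hdV dW hdW,
        ‖E S s h‖ ≤ C * u S * adelicHeightGL (n + n) L (h : GL (Fin (n + n)) (AdeleRing (𝓞 L) L)) ^ A) := by
  have hbdd : ∀ z : ℂ, 0 < z.re → ∃ C A r : ℝ, 0 ≤ C ∧ 0 ≤ A ∧ 0 < r ∧
      ∀ (S : skewMatrices ((IsCMField.complexConj L : L ≃ₐ[Fp L] L) : L →+* L) ((gramR L e dV hdV dW hdW).map (algebraMap (Fp L) L))) (s : ℂ),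
        dist s z < r → ∀ h : HA L e dV hdV dW hdW,
          ‖(fun (_ : skewMatrices ((IsCMField.complexConj L : L ≃ₐ[Fp L] L) : L →+* L) ((gramR L e dV hdV dW hdW).map (algebraMap (Fp L) L)))
              (_ : ℂ) (_ : HA L e dV hdV dW hdW) => (1 : ℂ)) S s h‖ ≤
            C * adelicHeightGL (n + n) L (h : GL (Fin (n + n)) (AdeleRing (𝓞 L) L)) ^ A :=
    fun _ _ => ⟨1, 0, 1, zero_le_one, le_rfl, one_pos, fun _ _ _ _ => by rw [norm_one, Real.rpow_zero, mul_one]⟩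
  obtain ⟨w, hw0, hws, hg⟩ := exists_whittaker_weight L hn e dV hdV dW hdW E (fun _ _ _ => (1 : ℂ)) τ hτ N₀ hdec hbdd hC₀ hκ
    (fun S s h hs hne => hsupp S s h hs (by rwa [mul_one] at hne))
  refine ⟨w, hw0, hws, fun z hz => ?_⟩
  obtain ⟨C, A, r, hC, hA, hr, hle⟩ := hg z hz
  exact ⟨C, A, r, hC, hA, hr, fun S s hs h => by simpa only [mul_one] using hle S s hs h⟩

include hn in
/-- **THE KIND-1 WEIGHT LETTERS `(ub uG hub huG hbg haG hws)` OF TOP ED. 16 ∕ ★ `exists_kindOne_sixLetters_of_record`, from (L-dec) + (L-supp) on `Ebc` and on `Eac`.**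
One size function `τ` serves both; the decay and support constants may differ.  OUTPUT (one `obtain`): `∃ ub uG, (∀ S, 0 ≤ ub S) ∧ (∀ S, 0 ≤ uG S) ∧ ‹hbg› ∧ ‹haG› ∧
Summable (fun S => ub S + uG S)`. [cite: MoeglinWaldspurger1995, II.1.7, IV.1.9] [cite: Tan1999, §4 Prop. 4.8] [cite: KudlaRallis1994, §1–§2] -/
theorem kindOne_weights_of_decay
    (Ebc Eac : skewMatrices ((IsCMField.complexConj L : L ≃ₐ[Fp L] L) : L →+* L) ((gramR L e dV hdV dW hdW).map (algebraMap (Fp L) L)) → ℂ → HA L e dV hdV dW hdW → ℂ)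
    (τ : skewMatrices ((IsCMField.complexConj L : L ≃ₐ[Fp L] L) : L →+* L) ((gramR L e dV hdV dW hdW).map (algebraMap (Fp L) L)) → ℝ)
    (hτ : ∀ S : skewMatrices ((IsCMField.complexConj L : L ≃ₐ[Fp L] L) : L →+* L) ((gramR L e dV hdV dW hdW).map (algebraMap (Fp L) L)),
      ‖(fun i j => mixedEmbedding L ((S : Matrix (Fin n) (Fin n) L) i j))‖ ≤ τ S) (Nb Na : ℕ)
    (hdecb : ∀ z : ℂ, 0 < z.re → ∃ C a c a' r : ℝ, 0 ≤ C ∧ 0 ≤ a ∧ 0 < c ∧ 0 ≤ a' ∧ 0 < r ∧ ∀ S (s : ℂ), dist s z < r → ∀ h : HA L e dV hdV dW hdW,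
      ‖Ebc S s h‖ ≤ C * adelicHeightGL (n + n) L (h : GL (Fin (n + n)) (AdeleRing (𝓞 L) L)) ^ a *
        (Real.exp (-(c * adelicHeightGL (n + n) L (h : GL (Fin (n + n)) (AdeleRing (𝓞 L) L)) ^ (-a') * τ S)) * (1 + τ S) ^ Nb))
    (hdeca : ∀ z : ℂ, 0 < z.re → ∃ C a c a' r : ℝ, 0 ≤ C ∧ 0 ≤ a ∧ 0 < c ∧ 0 ≤ a' ∧ 0 < r ∧ ∀ S (s : ℂ), dist s z < r → ∀ h : HA L e dV hdV dW hdW,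
      ‖Eac S s h‖ ≤ C * adelicHeightGL (n + n) L (h : GL (Fin (n + n)) (AdeleRing (𝓞 L) L)) ^ a *
        (Real.exp (-(c * adelicHeightGL (n + n) L (h : GL (Fin (n + n)) (AdeleRing (𝓞 L) L)) ^ (-a') * τ S)) * (1 + τ S) ^ Na))
    {Cb κb Ca κa : ℝ} (hCb : 0 < Cb) (hκb : 0 ≤ κb) (hCa : 0 < Ca) (hκa : 0 ≤ κa)
    (hsuppb : ∀ S (s : ℂ) (h : HA L e dV hdV dW hdW), 0 < s.re → Ebc S s h ≠ 0 →
      ∃ D : ℕ, 1 ≤ D ∧ (D : ℝ) ≤ Cb * adelicHeightGL (n + n) L (h : GL (Fin (n + n)) (AdeleRing (𝓞 L) L)) ^ κb ∧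
        ∀ i j, IsIntegral ℤ ((D : L) * (S : Matrix (Fin n) (Fin n) L) i j))
    (hsuppa : ∀ S (s : ℂ) (h : HA L e dV hdV dW hdW), 0 < s.re → Eac S s h ≠ 0 →
      ∃ D : ℕ, 1 ≤ D ∧ (D : ℝ) ≤ Ca * adelicHeightGL (n + n) L (h : GL (Fin (n + n)) (AdeleRing (𝓞 L) L)) ^ κa ∧
        ∀ i j, IsIntegral ℤ ((D : L) * (S : Matrix (Fin n) (Fin n) L) i j)) :
    ∃ ub uG : skewMatrices ((IsCMField.complexConj L : L ≃ₐ[Fp L] L) : L →+* L) ((gramR L e dV hdV dW hdW).map (algebraMap (Fp L) L)) → ℝ,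
      (∀ S, 0 ≤ ub S) ∧ (∀ S, 0 ≤ uG S) ∧
      (∀ z : ℂ, 0 < z.re → ∃ C A r : ℝ, 0 ≤ C ∧ 0 ≤ A ∧ 0 < r ∧ ∀ S (s : ℂ), dist s z < r → ∀ x : HA L e dV hdV dW hdW,
        ‖Ebc S s x‖ ≤ C * ub S * adelicHeightGL (n + n) L (x : GL (Fin (n + n)) (AdeleRing (𝓞 L) L)) ^ A) ∧
      (∀ z : ℂ, 0 < z.re → ∃ C A r : ℝ, 0 ≤ C ∧ 0 ≤ A ∧ 0 < r ∧ ∀ S (s : ℂ), dist s z < r → ∀ x : HA L e dV hdV dW hdW,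
        ‖Eac S s x‖ ≤ C * uG S * adelicHeightGL (n + n) L (x : GL (Fin (n + n)) (AdeleRing (𝓞 L) L)) ^ A) ∧
      (Summable fun S => ub S + uG S) := by
  obtain ⟨ub, hub, hubs, hbg⟩ := kindOne_weight_of_decay L hn e dV hdV dW hdW Ebc τ hτ Nb hdecb hCb hκb hsuppb
  obtain ⟨uG, huG, huGs, haG⟩ := kindOne_weight_of_decay L hn e dV hdV dW hdW Eac τ hτ Na hdeca hCa hκa hsuppa
  exact ⟨ub, uG, hub, huG, hbg, haG, hubs.add huGs⟩

end Summit.HodgeConjecture.HodgeConjecture.Cruxes.HLiu418.K2LiuKindOneWeightsOfDecay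

end
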